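import Mathlib
import HarnessLib

/-!
# Route `KLProgramme`, crux K3 `KLRegimeTwoPointLimit` — the exact single-scale LADDER ALGEBRA
# (DECOMP App. E, E2 (c1) «pure pp cascades»; Lemma E.5 (α); cell gate-hubbard-kl, seat p1 = C1 `BetaSplit` lead)

In the channel-resolved coupling induction of C1 (HOME/DECOMP.md App. E, Lemmas E.4–E.5; HOME/p1/E5-NOTE.md) the
particle–particle ladders formed at one scale `j` with vertex `V` (the Cooper-channel array of the running coupling
function) and bubble weight `P = P_j(q) ≥ 0` resum EXACTLY to the cascade `V (1 + P V)⁻¹`; the one-loop Riccati step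
keeps `V - V P V`, and the remainder is the explicit, FACTORISED cubic term
`V (1 + P V)⁻¹ - V + V P V = V P V P V (1 + P V)⁻¹`, every factor `V` of which is again evaluated at the SAME Cooper
transfer `q` — this is what lets Lemma E.4 sum the cubic terms with the decaying block envelopes of C2 instead of the
sign-blind `sup ‖λ‖` (DECOMP App. E, E.4: «the one place where a sign-blind sup bound would lose»).  The companion facts
are the push-through identity `V (1 + P V)⁻¹ = (1 + V P)⁻¹ V` (so the cascade is symmetric whenever `V, P` are), the
finite ladder expansion to any order with exact remainder (= the ladder sum `Σ_r (-1)^r V (P V)^r` of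
Feldman–Knörrer–Trubowitz, *Convergence of perturbation expansions in fermionic models II: overlapping loops*,
CMP 247 (2004) §VI, truncated), the second resolvent identity in the weight `P` (C2's «weights in a range»), and the
norm bounds in any normed ring with summable geometric series (in particular the complete normed ring `E →L[ℂ] E` of
p3's files `KLProgrammeCooperChannelRiccatiFlow*.lean`, where `P = b • 1 + Δ`).

Everything here is pure (noncommutative) ring algebra plus the geometric series; no analysis of the model is involved.
All statements are about `Ring.inverse` (`x⁻¹ʳ`), which agrees with the group inverse on units.
-/

namespace Summit.HubbardSuperconductivity.HubbardSuperconductivity.Theorems.CooperChannelLadderAlgebra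

set_option linter.dupNamespace false -- summit = problem name (single-conjunct summit), D-0017

open Finset

section Ring

variable {R : Type*} [Ring R]

/-- For a unit `1 - t`: `(1 - t)⁻¹ = Σ_{i<n} tⁱ + tⁿ (1 - t)⁻¹` (finite geometric expansion with exact remainder). -/
theorem inverse_one_sub_eq_geom_sum_add (t : R) (h : IsUnit (1 - t)) (n : ℕ) :
    Ring.inverse (1 - t) = (∑ i ∈ range n, t ^ i) + t ^ n * Ring.inverse (1 - t) := by
  have hmul : (∑ i ∈ range n, t ^ i) * (1 - t) = 1 - t ^ n := geom_sum_mul_neg t n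
  have key : (∑ i ∈ range n, t ^ i) = (1 - t ^ n) * Ring.inverse (1 - t) := by
    calc (∑ i ∈ range n, t ^ i) = (∑ i ∈ range n, t ^ i) * ((1 - t) * Ring.inverse (1 - t)) := by
          rw [Ring.mul_inverse_cancel _ h, mul_one]
      _ = (1 - t ^ n) * Ring.inverse (1 - t) := by rw [← mul_assoc, hmul]
  rw [key, sub_mul, one_mul, sub_add_cancel]

/-- `1 + P V` is a unit iff `1 + V P` is (with inverse `1 - V (1 + P V)⁻¹ P`): one direction, constructively. -/
theorem isUnit_one_add_mul_swap (P V : R) (h : IsUnit (1 + P * V)) : IsUnit (1 + V * P) := by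
  set u := Ring.inverse (1 + P * V) with hu
  have h1 : (1 + P * V) * u = 1 := Ring.mul_inverse_cancel _ h
  have h2 : u * (1 + P * V) = 1 := Ring.inverse_mul_cancel _ h
  refine ⟨⟨1 + V * P, 1 - V * u * P, ?_, ?_⟩, rfl⟩
  · -- (1 + V P)(1 - V u P) = 1 + V P - V (1 + P V) u P = 1
    have : (1 + V * P) * (1 - V * u * P) = 1 + V * P - V * ((1 + P * V) * u) * P := by noncomm_ring
    rw [this, h1]; noncomm_ring
  · have : (1 - V * u * P) * (1 + V * P) = 1 + V * P - V * (u * (1 + P * V)) * P := by noncomm_ring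
    rw [this, h2]; noncomm_ring

/-- **Push-through identity.** If `1 + P V` is a unit then `V (1 + P V)⁻¹ = (1 + V P)⁻¹ V`. -/
theorem mul_inverse_one_add_eq_inverse_one_add_mul (P V : R) (h : IsUnit (1 + P * V)) :
    V * Ring.inverse (1 + P * V) = Ring.inverse (1 + V * P) * V := by
  have h' : IsUnit (1 + V * P) := isUnit_one_add_mul_swap P V h
  -- (1 + V P) V = V (1 + P V)
  have comm : (1 + V * P) * V = V * (1 + P * V) := by noncomm_ring
  calc V * Ring.inverse (1 + P * V)
      = Ring.inverse (1 + V * P) * ((1 + V * P) * V) * Ring.inverse (1 + P * V) := by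
          rw [← mul_assoc, Ring.inverse_mul_cancel _ h', one_mul]
    _ = Ring.inverse (1 + V * P) * V * ((1 + P * V) * Ring.inverse (1 + P * V)) := by
          rw [comm]; noncomm_ring
    _ = Ring.inverse (1 + V * P) * V := by rw [Ring.mul_inverse_cancel _ h, mul_one]

/-- **Finite ladder expansion with exact remainder.** If `1 + P V` is a unit then, for every `n`,
`V (1 + P V)⁻¹ = Σ_{i<n} V (-(P V))ⁱ + V (-(P V))ⁿ (1 + P V)⁻¹` — the single-scale particle–particle ladder sum
truncated after `n` rungs, the remainder being the `n`-rung ladder closed by the full cascade. -/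
theorem ladder_expansion (P V : R) (h : IsUnit (1 + P * V)) (n : ℕ) :
    V * Ring.inverse (1 + P * V)
      = (∑ i ∈ range n, V * (-(P * V)) ^ i) + V * (-(P * V)) ^ n * Ring.inverse (1 + P * V) := by
  have e : (1 : R) + P * V = 1 - -(P * V) := by rw [sub_neg_eq_add]
  have h' : IsUnit (1 - -(P * V)) := by rwa [← e]
  have key := inverse_one_sub_eq_geom_sum_add (-(P * V)) h' n
  rw [← e] at key
  conv_lhs => rw [key]
  rw [mul_add, mul_sum, mul_assoc]

/-- **The cubic cascade remainder, factorised** (DECOMP App. E, E2 (c1)): if `1 + P V` is a unit then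
`V (1 + P V)⁻¹ - V + V P V = V P V P V (1 + P V)⁻¹`. -/
theorem cascade_sub_riccati_eq (P V : R) (h : IsUnit (1 + P * V)) :
    V * Ring.inverse (1 + P * V) - V + V * P * V
      = V * P * V * P * V * Ring.inverse (1 + P * V) := by
  have := ladder_expansion P V h 2
  rw [sum_range_succ, sum_range_one, pow_zero, mul_one, pow_one] at this
  rw [this]
  noncomm_ring

/-- The same identity read as «cascade = Riccati step + cubic ladder tail»:
`V (1 + P V)⁻¹ = V - V P V + V P V P V (1 + P V)⁻¹`. -/
theorem cascade_eq_riccati_add (P V : R) (h : IsUnit (1 + P * V)) :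
    V * Ring.inverse (1 + P * V) = V - V * P * V + V * P * V * P * V * Ring.inverse (1 + P * V) := by
  rw [← cascade_sub_riccati_eq P V h]; abel

/-- **Second resolvent identity in the bubble weight** (C2's «weights in a range»): if `1 + P V` and `1 + P' V` are
units then `V (1 + P' V)⁻¹ - V (1 + P V)⁻¹ = - (V (1 + P V)⁻¹ (P' - P) V (1 + P' V)⁻¹)`. -/
theorem cascade_sub_cascade_eq (P P' V : R) (h : IsUnit (1 + P * V)) (h' : IsUnit (1 + P' * V)) :
    V * Ring.inverse (1 + P' * V) - V * Ring.inverse (1 + P * V)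
      = -(V * Ring.inverse (1 + P * V) * (P' - P) * V * Ring.inverse (1 + P' * V)) := by
  set u := Ring.inverse (1 + P * V)
  set u' := Ring.inverse (1 + P' * V)
  have hu : u * (1 + P * V) = 1 := Ring.inverse_mul_cancel _ h
  have hu' : (1 + P' * V) * u' = 1 := Ring.mul_inverse_cancel _ h'
  -- V u' - V u = V u [(1+PV) u' ] - V [u ... ]  ; write both with u (1+PV) = 1 and (1+P'V) u' = 1 inserted
  calc V * u' - V * u
      = V * (u * (1 + P * V)) * u' - V * u * ((1 + P' * V) * u') := by rw [hu, hu', mul_one, mul_one]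
    _ = -(V * u * (P' - P) * V * u') := by noncomm_ring

end Ring

section Normed

variable {R : Type*} [NormedRing R] [HasSummableGeomSeries R]

/-- In a normed ring with summable geometric series, `‖P‖ ‖V‖ < 1` makes `1 + P V` a unit. -/
theorem isUnit_one_add_mul_of_norm_mul_lt_one (P V : R) (h : ‖P‖ * ‖V‖ < 1) : IsUnit (1 + P * V) := by
  have hn : ‖-(P * V)‖ < 1 := by
    rw [norm_neg]; exact (norm_mul_le _ _).trans_lt h
  simpa [sub_neg_eq_add] using isUnit_one_sub_of_norm_lt_one hn

/-- Norm of the cascade resolvent: `‖(1 + P V)⁻¹‖ ≤ ‖1‖ - 1 + (1 - ‖P‖ ‖V‖)⁻¹` (no `‖1‖ = 1` assumed). -/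
theorem norm_inverse_one_add_mul_le (P V : R) (h : ‖P‖ * ‖V‖ < 1) :
    ‖Ring.inverse (1 + P * V)‖ ≤ ‖(1 : R)‖ - 1 + (1 - ‖P‖ * ‖V‖)⁻¹ := by
  have hPV : ‖-(P * V)‖ < 1 := by
    rw [norm_neg]; exact (norm_mul_le _ _).trans_lt h
  have e : Ring.inverse (1 + P * V) = ∑' i : ℕ, (-(P * V)) ^ i := by
    rw [geom_series_eq_inverse _ hPV, sub_neg_eq_add]
  rw [e]
  refine (tsum_geometric_le_of_norm_lt_one _ hPV).trans ?_
  have h1 : ‖-(P * V)‖ ≤ ‖P‖ * ‖V‖ := by rw [norm_neg]; exact norm_mul_le _ _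
  have h2 : 0 < 1 - ‖P‖ * ‖V‖ := by linarith
  have : (1 - ‖-(P * V)‖)⁻¹ ≤ (1 - ‖P‖ * ‖V‖)⁻¹ := by
    apply inv_anti₀ h2; linarith
  linarith

omit [HasSummableGeomSeries R] in
/-- `‖a bⁿ‖ ≤ ‖a‖ ‖b‖ⁿ` for every `n` (at `n = 0` both sides are `‖a‖`; no `‖1‖ = 1` needed). -/
theorem norm_mul_pow_le (a b : R) (n : ℕ) : ‖a * b ^ n‖ ≤ ‖a‖ * ‖b‖ ^ n := by
  rcases Nat.eq_zero_or_pos n with rfl | hn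
  · simp
  · exact (norm_mul_le _ _).trans (mul_le_mul_of_nonneg_left (norm_pow_le' b hn) (norm_nonneg _))

/-- **Norm bound on the truncated ladder remainder**: for `‖P‖ ‖V‖ < 1` and every `n`,
`‖V (1 + P V)⁻¹ - Σ_{i<n} V (-(P V))ⁱ‖ ≤ ‖V‖ⁿ⁺¹ ‖P‖ⁿ (‖1‖ - 1 + (1 - ‖P‖ ‖V‖)⁻¹)`. -/
theorem norm_cascade_sub_ladder_sum_le (P V : R) (h : ‖P‖ * ‖V‖ < 1) (n : ℕ) :
    ‖V * Ring.inverse (1 + P * V) - ∑ i ∈ range n, V * (-(P * V)) ^ i‖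
      ≤ ‖V‖ ^ (n + 1) * ‖P‖ ^ n * (‖(1 : R)‖ - 1 + (1 - ‖P‖ * ‖V‖)⁻¹) := by
  have hu := isUnit_one_add_mul_of_norm_mul_lt_one P V h
  rw [ladder_expansion P V hu n, add_sub_cancel_left]
  have hK := norm_inverse_one_add_mul_le P V h
  have hK0 : 0 ≤ ‖Ring.inverse (1 + P * V)‖ := norm_nonneg _
  have ht : ‖-(P * V)‖ ≤ ‖P‖ * ‖V‖ := by rw [norm_neg]; exact norm_mul_le _ _
  calc ‖V * (-(P * V)) ^ n * Ring.inverse (1 + P * V)‖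
      ≤ ‖V * (-(P * V)) ^ n‖ * ‖Ring.inverse (1 + P * V)‖ := norm_mul_le _ _
    _ ≤ ‖V‖ * ‖-(P * V)‖ ^ n * ‖Ring.inverse (1 + P * V)‖ :=
          mul_le_mul_of_nonneg_right (norm_mul_pow_le _ _ n) hK0
    _ ≤ ‖V‖ * (‖P‖ * ‖V‖) ^ n * (‖(1 : R)‖ - 1 + (1 - ‖P‖ * ‖V‖)⁻¹) := by gcongr
    _ = ‖V‖ ^ (n + 1) * ‖P‖ ^ n * (‖(1 : R)‖ - 1 + (1 - ‖P‖ * ‖V‖)⁻¹) := by ring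

/-- **The cubic cascade remainder is `O(‖V‖³ ‖P‖²)`**: for `‖P‖ ‖V‖ < 1`,
`‖V (1 + P V)⁻¹ - V + V P V‖ ≤ ‖V‖³ ‖P‖² (‖1‖ - 1 + (1 - ‖P‖ ‖V‖)⁻¹)`. -/
theorem norm_cascade_sub_riccati_le (P V : R) (h : ‖P‖ * ‖V‖ < 1) :
    ‖V * Ring.inverse (1 + P * V) - V + V * P * V‖
      ≤ ‖V‖ ^ 3 * ‖P‖ ^ 2 * (‖(1 : R)‖ - 1 + (1 - ‖P‖ * ‖V‖)⁻¹) := by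
  have := norm_cascade_sub_ladder_sum_le P V h 2
  rw [sum_range_succ, sum_range_one, pow_zero, mul_one, pow_one] at this
  have e : V * Ring.inverse (1 + P * V) - V + V * P * V
      = V * Ring.inverse (1 + P * V) - (V + V * -(P * V)) := by noncomm_ring
  rw [e]; exact this

/-- **Weights in a range**: for `‖P‖ ‖V‖ < 1`, `‖P'‖ ‖V‖ < 1`,
`‖V (1 + P' V)⁻¹ - V (1 + P V)⁻¹‖ ≤ ‖V‖² ‖P' - P‖ K K'` with `K, K'` the two resolvent bounds. -/
theorem norm_cascade_sub_cascade_le (P P' V : R) (h : ‖P‖ * ‖V‖ < 1) (h' : ‖P'‖ * ‖V‖ < 1) :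
    ‖V * Ring.inverse (1 + P' * V) - V * Ring.inverse (1 + P * V)‖
      ≤ ‖V‖ ^ 2 * ‖P' - P‖ * ((‖(1 : R)‖ - 1 + (1 - ‖P‖ * ‖V‖)⁻¹) * (‖(1 : R)‖ - 1 + (1 - ‖P'‖ * ‖V‖)⁻¹)) := by
  have hu := isUnit_one_add_mul_of_norm_mul_lt_one P V h
  have hu' := isUnit_one_add_mul_of_norm_mul_lt_one P' V h'
  rw [cascade_sub_cascade_eq P P' V hu hu', norm_neg]
  have hK := norm_inverse_one_add_mul_le P V h
  have hK' := norm_inverse_one_add_mul_le P' V h'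
  set K := ‖Ring.inverse (1 + P * V)‖
  set K' := ‖Ring.inverse (1 + P' * V)‖
  have hC : 0 ≤ ‖(1 : R)‖ - 1 + (1 - ‖P‖ * ‖V‖)⁻¹ := (norm_nonneg _).trans hK
  calc ‖V * Ring.inverse (1 + P * V) * (P' - P) * V * Ring.inverse (1 + P' * V)‖
      ≤ ‖V‖ * K * ‖P' - P‖ * ‖V‖ * K' := by
          refine (norm_mul_le _ _).trans ?_
          refine mul_le_mul_of_nonneg_right ?_ (norm_nonneg _)
          refine (norm_mul_le _ _).trans ?_
          refine mul_le_mul_of_nonneg_right ?_ (norm_nonneg _)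
          refine (norm_mul_le _ _).trans ?_
          exact mul_le_mul_of_nonneg_right (norm_mul_le _ _) (norm_nonneg _)
    _ ≤ ‖V‖ * (‖(1 : R)‖ - 1 + (1 - ‖P‖ * ‖V‖)⁻¹) * ‖P' - P‖ * ‖V‖
          * (‖(1 : R)‖ - 1 + (1 - ‖P'‖ * ‖V‖)⁻¹) := by
          have h1 : ‖V‖ * K * ‖P' - P‖ * ‖V‖ ≤ ‖V‖ * (‖(1 : R)‖ - 1 + (1 - ‖P‖ * ‖V‖)⁻¹) * ‖P' - P‖ * ‖V‖ := by
            gcongr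
          exact mul_le_mul h1 hK' (norm_nonneg _)
            (mul_nonneg (mul_nonneg (mul_nonneg (norm_nonneg _) hC) (norm_nonneg _)) (norm_nonneg _))
    _ = _ := by ring

end Normed

end Summit.HubbardSuperconductivity.HubbardSuperconductivity.Theorems.CooperChannelLadderAlgebra
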